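import Summits.SmoothPoincare4.SmoothPoincare4.Theses.EntropyRung
import Summits.SmoothPoincare4.SmoothPoincare4.Theorems.EntropyRungSubcylindricalExistenceCapFactorRound
import Summits.SmoothPoincare4.SmoothPoincare4.Theorems.EntropyRungSubcylindricalExistenceGradSqFlatChart
import Literature.Geometry.Lorentzian.DalembertianCompose
import Literature.Geometry.Lorentzian.ChartLaplacian
import Mathlib.Analysis.Calculus.Gradient.Basic
import HarnessLib

/-!
# The cap factor `ψ_K = θ_K ∘ G` of the Green-function blow-up in the Schwarzschild gauge
(stub S3' `stub_capFactorSchwarzschild` of line `green-blowup-conformal-entropy`, crux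
`EntropyRung.SubcylindricalExistence`, item stmt-SmoothPoincare4-10871, lead c3, reshape R-c3)

For a smooth Riemannian metric `g` (Levi-Civita) with `R_g ≥ 0` on a 4-manifold of the summit
binder, Green data `(p, G)` (`G` smooth and positive off `p`, `R G − 6 Δ_g G = 0` off `p`) in the
flat gauge WITH MASS at `p` (`φ = extChartAt p`, `y₀ = φ p`: `B̄(y₀, r) ⊆ φ.target`, `φ⁻¹` a
`g`-isometry there, `G ∘ φ⁻¹ = a/‖· − y₀‖² + b` on the punctured closed ball with constants `a > 0`,
`b ≥ 0`, and `R_g = 0` only on that ball), the function `ψ_K = 4KG/(4K + G)` off `p`, `ψ_K(p) = 4K`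
(`K > 0`), is smooth, positive, and `L_g ψ_K = R ψ_K − 6 Δ_g ψ_K > 0` everywhere.

This is lead c2's round case `b = 0` (`stub_capFactorRound`, whose gauge-free lemmas
`CapFactorRound.*` are reused by import) with three changes.
* The Euclidean gradient of the model `a/‖· − y₀‖² + b` is that of `a/‖· − y₀‖²` (the mass term is
  constant), so on the punctured closed flat ball `|∇G|²_g = 4a²/‖y − y₀‖⁶` still holds, by the
  landed flat-chart gradient identity S0 (`stub_gradSqFlatChart`).
* Through the pole, `ψ_K ∘ φ⁻¹ = 4K(a + b‖y − y₀‖²)/((4K + b)‖y − y₀‖² + a)` on the whole closed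
  ball (value `4K` at `y₀`, denominator `≥ a > 0`), a smooth function on `ℝ⁴`.
* Off `p`, `L_g ψ_K = R · 4KG²/(4K+G)² + 192K² |∇G|²_g/(4K+G)³` (chain rule for `Δ_g`,
  `dalembertian_real_comp`, and `6 Δ_g G = R G`); it is `> 0` where `R > 0`, and on the punctured
  flat ball (`G = a/ρ² + b`, `ρ = ‖y − y₀‖ ≤ r`) it is
  `≥ 192K² · (4a²/ρ⁶)/(4K + b + a/ρ²)³ = 768K²a²/((4K+b)ρ² + a)³ ≥ 768K²a²/((4K+b)r² + a)³ > 0`;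
  the bound passes to `p` by continuity of `L_g ψ_K` along the chart ray
  (`CapFactorRound.le_conformalLaplacian_pole`). Points with `R = 0` lie on the closed flat ball.
References: Schoen 1984; Lee–Parker 1987, §2 (the conformal Laplacian `−6Δ_g + R_g` in
dimension 4) and §6 (the Green-function blow-up, expansion `G = a/ρ² + A + O(ρ)`).
-/

noncomputable section

-- the registered namespace `Summit.SmoothPoincare4.SmoothPoincare4.Theorems` repeats a component
set_option linter.dupNamespace false

open scoped Manifold ContDiff Topology RealInnerProductSpace
open Set Filter MeasureTheory
open Literature.Geometry.Lorentzian

namespace Summit.SmoothPoincare4.SmoothPoincare4.Theorems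

namespace CapFactorSchwarzschild

open CapFactorRound

section OffPole

open scoped Classical

variable {M : Type*} [TopologicalSpace M] [ChartedSpace (EuclideanSpace ℝ (Fin 4)) M]
  [IsManifold (𝓡 4) ∞ M]
  (g : PseudoRiemannianMetric (𝓡 4) ∞ (EuclideanSpace ℝ (Fin 4)) (TangentSpace (𝓡 4) : M → Type _))
  {p : M} {G : M → ℝ} {K a b r : ℝ} {y : EuclideanSpace ℝ (Fin 4)}

/-- **The Euclidean gradient of `G ∘ φ⁻¹` on the punctured closed flat ball, Schwarzschild
gauge**, boundary included: it is the gradient `-(2a/‖y - y₀‖⁴)(y - y₀)` of the massless model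
`a/‖· - y₀‖²` (the mass `b` is constant), with whose translate `a/‖· - y₀‖² + b` the function
`G ∘ φ⁻¹` agrees on the punctured closed ball — a convex set of unique differentiability.
[folklore] -/
theorem gradient_green_comp_symm [T1Space M] (hGs : ContMDiffOn (𝓡 4) 𝓘(ℝ, ℝ) ∞ G {p}ᶜ)
    (hr : 0 < r) (hsub : Metric.closedBall (extChartAt (𝓡 4) p p) r ⊆ (extChartAt (𝓡 4) p).target)
    (hGeq : ∀ y ∈ Metric.closedBall (extChartAt (𝓡 4) p p) r, y ≠ extChartAt (𝓡 4) p p →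
      G ((extChartAt (𝓡 4) p).symm y) = a / ‖y - extChartAt (𝓡 4) p p‖ ^ 2 + b)
    (hy : y ∈ Metric.closedBall (extChartAt (𝓡 4) p p) r) (hne : y ≠ extChartAt (𝓡 4) p p) :
    gradient (G ∘ (extChartAt (𝓡 4) p).symm) y =
      (-(2 * a) / (‖y - extChartAt (𝓡 4) p p‖ ^ 2) ^ 2) • (y - extChartAt (𝓡 4) p p) := by
  have h1 : DifferentiableAt ℝ (G ∘ (extChartAt (𝓡 4) p).symm) y := by
    have hs : ContMDiffAt 𝓘(ℝ, EuclideanSpace ℝ (Fin 4)) (𝓡 4) ∞ (extChartAt (𝓡 4) p).symm y :=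
      (contMDiffOn_extChartAt_symm p y (hsub hy)).contMDiffAt
        ((isOpen_extChartAt_target p).mem_nhds (hsub hy))
    exact (contMDiffAt_iff_contDiffAt.mp ((contMDiffAt_green hGs
      (extChartAt_symm_ne_pole (hsub hy) hne)).comp y hs)).differentiableAt (by simp)
  have h2 : HasGradientAt (fun z : EuclideanSpace ℝ (Fin 4) ↦
      a / ‖z - extChartAt (𝓡 4) p p‖ ^ 2 + b)
      ((-(2 * a) / (‖y - extChartAt (𝓡 4) p p‖ ^ 2) ^ 2) • (y - extChartAt (𝓡 4) p p)) y := by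
    rw [hasGradientAt_iff_hasFDerivAt]
    exact (hasGradientAt_iff_hasFDerivAt.mp (hasGradientAt_model a hne)).add_const b
  have hU : UniqueDiffWithinAt ℝ (Metric.closedBall (extChartAt (𝓡 4) p p) r) y :=
    uniqueDiffWithinAt_convex (convex_closedBall _ _)
      ⟨extChartAt (𝓡 4) p p, Metric.ball_subset_interior_closedBall (Metric.mem_ball_self hr)⟩
      (subset_closure hy)
  have hev : (G ∘ (extChartAt (𝓡 4) p).symm) =ᶠ[𝓝[Metric.closedBall (extChartAt (𝓡 4) p p) r] y]
      fun z ↦ a / ‖z - extChartAt (𝓡 4) p p‖ ^ 2 + b := by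
    rw [EventuallyEq, eventually_nhdsWithin_iff]
    filter_upwards [isOpen_compl_singleton.mem_nhds
      (show y ∈ ({extChartAt (𝓡 4) p p}ᶜ : Set _) by simpa using hne)] with z hz hzs
    exact hGeq z hzs (by simpa using hz)
  rw [← h2.gradient, gradient, gradient, ← h1.fderivWithin hU,
    ← h2.differentiableAt.fderivWithin hU, hev.fderivWithin_eq (hGeq y hy hne)]

omit [IsManifold (𝓡 4) ∞ M] in
/-- Near the pole, `ψ_K = F ∘ φ` with the smooth Euclidean profile
`F(z) = 4K(a + b‖z − y₀‖²)/((4K + b)‖z − y₀‖² + a)` (`G ∘ φ⁻¹ = a/‖· − y₀‖² + b` on the flat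
ball; value `4K` at `y₀`). [folklore] -/
theorem psi_eventuallyEq_pole (hK : 0 < K) (ha : 0 < a) (hb : 0 ≤ b) (hr : 0 < r)
    (hGeq : ∀ y ∈ Metric.closedBall (extChartAt (𝓡 4) p p) r, y ≠ extChartAt (𝓡 4) p p →
      G ((extChartAt (𝓡 4) p).symm y) = a / ‖y - extChartAt (𝓡 4) p p‖ ^ 2 + b) :
    (fun x : M ↦ if x = p then 4 * K else 4 * K * G x / (4 * K + G x)) =ᶠ[𝓝 p]
      ((fun z : EuclideanSpace ℝ (Fin 4) ↦
          4 * K * (a + b * ‖z - extChartAt (𝓡 4) p p‖ ^ 2) /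
            ((4 * K + b) * ‖z - extChartAt (𝓡 4) p p‖ ^ 2 + a)) ∘ extChartAt (𝓡 4) p) := by
  filter_upwards [extChartAt_source_mem_nhds (I := 𝓡 4) p,
    (continuousAt_extChartAt (I := 𝓡 4) p).preimage_mem_nhds
      (Metric.closedBall_mem_nhds _ hr)] with x hxs hxb
  by_cases hx : x = p
  · subst hx
    rw [if_pos rfl, Function.comp_apply, sub_self, norm_zero, sq, mul_zero, mul_zero, mul_zero,
      add_zero, zero_add, mul_div_assoc, div_self ha.ne', mul_one]
  · have hne : extChartAt (𝓡 4) p x ≠ extChartAt (𝓡 4) p p := extChartAt_ne_pole hxs hx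
    have hGx : G x = a / ‖extChartAt (𝓡 4) p x - extChartAt (𝓡 4) p p‖ ^ 2 + b := by
      have := hGeq (extChartAt (𝓡 4) p x) hxb hne
      rwa [(extChartAt (𝓡 4) p).left_inv hxs] at this
    have hd : 0 < ‖extChartAt (𝓡 4) p x - extChartAt (𝓡 4) p p‖ :=
      norm_pos_iff.mpr (sub_ne_zero.mpr hne)
    have h1 : (4 * K + b) * ‖extChartAt (𝓡 4) p x - extChartAt (𝓡 4) p p‖ ^ 2 + a ≠ 0 := by
      positivity
    have h2 : 4 * K + (a / ‖extChartAt (𝓡 4) p x - extChartAt (𝓡 4) p p‖ ^ 2 + b) ≠ 0 := by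
      positivity
    simp only [if_neg hx, Function.comp_apply, hGx]
    rw [div_eq_div_iff h2 h1]
    field_simp
    ring

omit [IsManifold (𝓡 4) ∞ M] in
/-- **`ψ_K` is smooth** (Schwarzschild gauge): off `p` it is `θ_K ∘ G` (`θ_K` smooth on
`s > -4K`, `G > 0`), near `p` it is `F ∘ φ` with `F` smooth on all of `ℝ⁴` (its denominator
`(4K + b)‖z − y₀‖² + a` is `≥ a > 0`). [folklore] -/
theorem psi_contMDiff [T1Space M] (hK : 0 < K) (ha : 0 < a) (hb : 0 ≤ b) (hr : 0 < r)
    (hGs : ContMDiffOn (𝓡 4) 𝓘(ℝ, ℝ) ∞ G {p}ᶜ) (hGpos : ∀ x, x ≠ p → 0 < G x)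
    (hGeq : ∀ y ∈ Metric.closedBall (extChartAt (𝓡 4) p p) r, y ≠ extChartAt (𝓡 4) p p →
      G ((extChartAt (𝓡 4) p).symm y) = a / ‖y - extChartAt (𝓡 4) p p‖ ^ 2 + b) :
    ContMDiff (𝓡 4) 𝓘(ℝ, ℝ) ∞
      (fun x : M ↦ if x = p then 4 * K else 4 * K * G x / (4 * K + G x)) := by
  intro x
  by_cases hx : x = p
  · subst hx
    have hF : ContDiff ℝ ∞ (fun z : EuclideanSpace ℝ (Fin 4) ↦
        4 * K * (a + b * ‖z - extChartAt (𝓡 4) x x‖ ^ 2) /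
          ((4 * K + b) * ‖z - extChartAt (𝓡 4) x x‖ ^ 2 + a)) :=
      (contDiff_const.mul (contDiff_const.add
        (contDiff_const.mul ((contDiff_id.sub contDiff_const).norm_sq ℝ)))).div
        ((contDiff_const.mul ((contDiff_id.sub contDiff_const).norm_sq ℝ)).add contDiff_const)
        (fun z ↦ by positivity)
    exact (hF.contDiffAt.comp_contMDiffAt contMDiffAt_extChartAt).congr_of_eventuallyEq
      (psi_eventuallyEq_pole hK ha hb hr hGeq)
  · exact ((contDiffAt_moebius K (by linarith [hGpos x hx])).comp_contMDiffAt
      (contMDiffAt_green hGs hx)).congr_of_eventuallyEq (psi_eventuallyEq_comp hx)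

variable [g.HasLeviCivita]

/-- **The uniform lower bound on the flat ball, Schwarzschild gauge**: for `y` in the punctured
closed flat ball (where the flat-chart gradient identity S0 holds),
`L_g ψ_K (φ⁻¹ y) ≥ 768K²a²/((4K + b)r² + a)³` (`R ≥ 0`, `G = a/‖y−y₀‖² + b`,
`|∇G|²_g = 4a²/‖y−y₀‖⁶`). Lee–Parker 1987, §2 and §6. [folklore] -/
theorem conformalLaplacian_psi_ge [T1Space M] (hK : 0 < K) (ha : 0 < a) (hb : 0 ≤ b)
    (hR : ∀ x, 0 ≤ g.scalarCurvature x)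
    (hGs : ContMDiffOn (𝓡 4) 𝓘(ℝ, ℝ) ∞ G {p}ᶜ) (hGpos : ∀ x, x ≠ p → 0 < G x)
    (hGreen : ∀ x, x ≠ p → g.scalarCurvature x * G x - 6 * g.dalembertian G x = 0) (hr : 0 < r)
    (hsub : Metric.closedBall (extChartAt (𝓡 4) p p) r ⊆ (extChartAt (𝓡 4) p).target)
    (hGeq : ∀ y ∈ Metric.closedBall (extChartAt (𝓡 4) p p) r, y ≠ extChartAt (𝓡 4) p p →
      G ((extChartAt (𝓡 4) p).symm y) = a / ‖y - extChartAt (𝓡 4) p p‖ ^ 2 + b)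
    (hy : y ∈ Metric.closedBall (extChartAt (𝓡 4) p p) r) (hne : y ≠ extChartAt (𝓡 4) p p)
    (hS0y : ∀ f : M → ℝ, MDifferentiableAt (𝓡 4) 𝓘(ℝ, ℝ) f ((extChartAt (𝓡 4) p).symm y) →
      g.gradSq f ((extChartAt (𝓡 4) p).symm y)
        = ‖gradient (f ∘ (extChartAt (𝓡 4) p).symm) y‖ ^ 2) :
    768 * K ^ 2 * a ^ 2 / ((4 * K + b) * r ^ 2 + a) ^ 3 ≤
      g.scalarCurvature ((extChartAt (𝓡 4) p).symm y)
          * (if (extChartAt (𝓡 4) p).symm y = p then 4 * K else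
              4 * K * G ((extChartAt (𝓡 4) p).symm y) / (4 * K + G ((extChartAt (𝓡 4) p).symm y)))
        - 6 * g.dalembertian (fun x : M ↦ if x = p then 4 * K else 4 * K * G x / (4 * K + G x))
          ((extChartAt (𝓡 4) p).symm y) := by
  have hx : (extChartAt (𝓡 4) p).symm y ≠ p := extChartAt_symm_ne_pole (hsub hy) hne
  have hgrad : g.gradSq G ((extChartAt (𝓡 4) p).symm y)
      = 4 * a ^ 2 / (‖y - extChartAt (𝓡 4) p p‖ ^ 2) ^ 3 := by
    rw [hS0y G ((contMDiffAt_green hGs hx).mdifferentiableAt (by simp)),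
      gradient_green_comp_symm hGs hr hsub hGeq hy hne, norm_model_gradient_sq a hne]
  rw [conformalLaplacian_psi_eq g hK hGs hGpos hGreen hx, hgrad, hGeq y hy hne]
  have hd : 0 < ‖y - extChartAt (𝓡 4) p p‖ := norm_pos_iff.mpr (sub_ne_zero.mpr hne)
  set D := ‖y - extChartAt (𝓡 4) p p‖ ^ 2 with hD
  have hDpos : 0 < D := by positivity
  have hDr : D ≤ r ^ 2 := pow_le_pow_left₀ (norm_nonneg _) (mem_closedBall_iff_norm.1 hy) 2
  have hA : 0 ≤ g.scalarCurvature ((extChartAt (𝓡 4) p).symm y)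
      * (4 * K * (a / D + b) ^ 2 / (4 * K + (a / D + b)) ^ 2) := mul_nonneg (hR _) (by positivity)
  have hB : 192 * K ^ 2 / (4 * K + (a / D + b)) ^ 3 * (4 * a ^ 2 / D ^ 3)
      = 768 * K ^ 2 * a ^ 2 / ((4 * K + b) * D + a) ^ 3 := by
    field_simp
    ring
  have hC : 768 * K ^ 2 * a ^ 2 / ((4 * K + b) * r ^ 2 + a) ^ 3
      ≤ 768 * K ^ 2 * a ^ 2 / ((4 * K + b) * D + a) ^ 3 :=
    div_le_div_of_nonneg_left (by positivity) (by positivity)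
      (pow_le_pow_left₀ (by positivity) (by nlinarith) 3)
  linarith [hA, hB, hC]

end OffPole

end CapFactorSchwarzschild

/-- **Stub S3' `stub_capFactorSchwarzschild` — the cap factor `ψ_K = θ_K ∘ G` in the
Schwarzschild gauge** (line `green-blowup-conformal-entropy`, crux stmt-SmoothPoincare4-10871,
reshape R-c3). Flat gauge with mass at `p` (`G ∘ φ⁻¹ = a/ρ² + b` on the punctured ball, `a > 0`,
`b ≥ 0`), Green data, `R_g ≥ 0` vanishing only on the flat ball. For `K > 0` the function
`ψ_K := 4KG/(4K+G)` off `p`, `ψ_K(p) := 4K`, is smooth, positive, and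
`L_g ψ_K = R_g ψ_K − 6Δ_g ψ_K > 0` everywhere: off `p`,
`L_g ψ_K = R · 4KG²/(4K+G)² + 192K²|∇G|²_g/(4K+G)³`, positive where `R > 0` and, on the flat ball,
because `|∇G|²_g = 4a²/ρ⁶ > 0` (S0 `stub_gradSqFlatChart`, the mass term being constant); at `p` by
continuity from the explicit lower bound `768K²a²/((4K+b)r²+a)³` on the punctured ball.
Schoen 1984; Lee–Parker 1987, §2 and §6. [folklore] -/
theorem stub_capFactorSchwarzschild :
    ∀ (M : Type) [TopologicalSpace M] [T2Space M] [SecondCountableTopology M]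
      [ChartedSpace (EuclideanSpace ℝ (Fin 4)) M] [IsManifold (𝓡 4) ∞ M] [CompactSpace M]
      [T3Space M] [MeasurableSpace M] [BorelSpace M]
      (g : PseudoRiemannianMetric (𝓡 4) ∞ (EuclideanSpace ℝ (Fin 4)) (TangentSpace (𝓡 4) : M → Type _))
      [g.HasLeviCivita], g.IsRiemannian → (∀ x, 0 ≤ g.scalarCurvature x) →
      ∀ (p : M) (G : M → ℝ),
        (ContMDiffOn (𝓡 4) 𝓘(ℝ, ℝ) ∞ G {p}ᶜ ∧ (∀ x, x ≠ p → 0 < G x) ∧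
          (∀ x, x ≠ p → g.scalarCurvature x * G x - 6 * g.dalembertian G x = 0) ∧
          Tendsto G (𝓝[≠] p) atTop) →
      ∀ (a b r : ℝ), 0 < a → 0 ≤ b → 0 < r →
        Metric.closedBall (extChartAt (𝓡 4) p p) r ⊆ (extChartAt (𝓡 4) p).target →
        (∀ y ∈ Metric.closedBall (extChartAt (𝓡 4) p p) r, ∀ X W : EuclideanSpace ℝ (Fin 4),
          g.val ((extChartAt (𝓡 4) p).symm y)
            (mfderiv 𝓘(ℝ, EuclideanSpace ℝ (Fin 4)) (𝓡 4) (extChartAt (𝓡 4) p).symm y X)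
            (mfderiv 𝓘(ℝ, EuclideanSpace ℝ (Fin 4)) (𝓡 4) (extChartAt (𝓡 4) p).symm y W) = ⟪X, W⟫) →
        (∀ y ∈ Metric.closedBall (extChartAt (𝓡 4) p p) r, y ≠ extChartAt (𝓡 4) p p →
          G ((extChartAt (𝓡 4) p).symm y) = a / ‖y - extChartAt (𝓡 4) p p‖ ^ 2 + b) →
        (∀ x, g.scalarCurvature x = 0 → x ∈ (extChartAt (𝓡 4) p).source ∧
          extChartAt (𝓡 4) p x ∈ Metric.closedBall (extChartAt (𝓡 4) p p) r) →
      ∀ (K : ℝ), 0 < K →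
        ∃ ψ : M → ℝ, ContMDiff (𝓡 4) 𝓘(ℝ, ℝ) ∞ ψ ∧ (∀ x, 0 < ψ x) ∧
          (∀ x, 0 < g.scalarCurvature x * ψ x - 6 * g.dalembertian ψ x) ∧
          (∀ x, x ≠ p → ψ x = 4 * K * G x / (4 * K + G x)) ∧ ψ p = 4 * K := by
  classical
  intro M _ _ _ _ _ _ _ _ _ g _ hg hR p G hGreen a b r ha hb hr hsub hflat hGeq hRzero K hK
  obtain ⟨hGs, hGpos, hGeqn, -⟩ := hGreen
  have hψ := CapFactorSchwarzschild.psi_contMDiff (K := K) hK ha hb hr hGs hGpos hGeq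
  have hflatBound := fun y hy hne ↦ CapFactorSchwarzschild.conformalLaplacian_psi_ge g hK ha hb hR
    hGs hGpos hGeqn hr hsub hGeq hy hne (stub_gradSqFlatChart M g p y (hsub hy) (hflat y hy))
  have hc : 0 < 768 * K ^ 2 * a ^ 2 / ((4 * K + b) * r ^ 2 + a) ^ 3 := by positivity
  refine ⟨_, hψ, fun x ↦ ?_, fun x ↦ ?_, fun x hx ↦ by simp [hx], by simp⟩
  · by_cases hx : x = p
    · rw [if_pos hx]; positivity
    · rw [if_neg hx]; have := hGpos x hx; positivity
  · by_cases hx : x = p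
    · subst hx
      exact hc.trans_le (CapFactorRound.le_conformalLaplacian_pole g hψ hr hflatBound)
    · rcases (hR x).eq_or_lt with h0 | hpos
      · obtain ⟨hxs, hxb⟩ := hRzero x h0.symm  -- `R x = 0`: `x` lies on the flat ball
        have key := hflatBound _ hxb (CapFactorRound.extChartAt_ne_pole hxs hx)
        rw [(extChartAt (𝓡 4) p).left_inv hxs] at key
        exact hc.trans_le key
      · rw [CapFactorRound.conformalLaplacian_psi_eq g hK hGs hGpos hGeqn hx]
        have hGx := hGpos x hx
        have h1 : 0 < g.scalarCurvature x * (4 * K * G x ^ 2 / (4 * K + G x) ^ 2) :=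
          mul_pos hpos (by positivity)
        have h2 : 0 ≤ 192 * K ^ 2 / (4 * K + G x) ^ 3 * g.gradSq G x :=
          mul_nonneg (by positivity) (g.gradSq_nonneg hg G x)
        linarith

end Summit.SmoothPoincare4.SmoothPoincare4.Theorems

end
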